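import Summits.QuantumFields.YangMills.Theorems.UnitScaleTiltProp8FlatPortCor28Pad
import Literature.MathematicalPhysics.QuantumFieldTheory.Balaban1983to89.B6Cor28EntriesKLevelV1L0
import Literature.MathematicalPhysics.QuantumFieldTheory.Balaban1983to89.B6PadLevelV1L0
import HarnessLib

/-!
# Route `UnitScaleTilt`, crux K1 child «MinimiserStabilityRegPr» (stmt-QuantumFields-19200), v8 pillar **P2 `stub_flatOpsCubeSeq`** — THE PORT BRIDGE, file 4:
# **[Balaban1984PropagatorsII] COROLLARY 2.8 (2.151)₁,₂ AT k LEVELS FOR EVERY TORUS FAMILY, EVERY ODD `L ≥ 5`, `k ≥ 1`, WITHOUT THE PLACEMENT HYPOTHESIS**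
# — lit-balaban's hypothesis-free `B6Cor28EntriesKLevelV1L0.cor28_kLevel_H_DH` (binders: `k ≥ 2`, `P′ ≥ 5`, every cube of the cover PLACED in the canonical chart —
# dischargeable as stated only at `L = 5`, `B6CubeWindowV1L0.placed_all_cubes`) applied to p38's PADDED family `B6PadLevelV1L0.padT D` (one empty top level: every cube
# lies below the top, `placed_pad`; `k + 1 ≥ 2`) and transported back along `B6PadLevelV1L0.sameOm_domT_pad` (same `Ω_j`, same `Δ_a`, `G`, `Q`, `Q*`, hence the same
# `(QGQ*)⁻¹` and `H = GQ*(QGQ*)⁻¹`; same blocks, same carrier blocks `β`, same distance (2.46))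

**LEVEL-0 TWIN** of `UnitScaleTiltProp8FlatPortCor28Pad` (GAP LIST v22 (P2-L0)): the same statements for lit-balaban's LEVEL-0-ADMITTING torus families
`B6MultiLevelTorusOperatorL0.TDomains` (blocks of every level `0 ≤ j ≤ k` — the P2 text's `Adm22` families have unit cubes `Λ₀ ≠ ∅` in general), obtained from the
gen-17 file by the dictionary swap `B6GlobalChartV1L0.{blkV1, domT}`, `B6Geom246MultiLevel{Box,Torus}L0`, `B6Ineq2142KLevelV1L0.β`, the `…KLevelV1L0` rows of
lit-balaban's S-E port, and `UnitScaleTiltProp8FlatPort*L0`; the `D`-free lemmas of the gen-17 file (`UI_single`, `qgqE_UI`, `EE_UI`, `H_UI`, `onFun_H_single`) are reused by name, not restated.  Seat `ym3-torus-p1` gen 18.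

Cell `ym3-torus` (HUMAN RULING D-0037, YM ladder rung R3), seat `ym3-torus-p1` gen 17.  `--supports stmt-QuantumFields-19200 --as helper`; count-neutral; def-free.

WHY (P2 side).  The P2 text `FlatCubeOpsText.FlatOpsAdmAtMS` quantifies over every odd `L > 1` and every height `k = K − n ≥ 1`; the port's k-level rows carry `4 ≤ ℓ`
(`L ≥ 5`), `2 ≤ k` and the chart-placement of the top cubes.  Padding (print p. 224: *«we admit the case when some domains Ω_j are equal to T_η»* — and empty top
domains change nothing) removes the last two at once; `L = 3` stays a named sub-gap (G-F3′-L0∕L3).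

WHAT IS PROVED (sorry-free; axioms standard; no definition), for `SameOm`-related V1 data and for the padded torus family:
* §1 transport along `B6PadLevelV1.SameOm h`: `UI_single` (coordinate vectors), `qgqE_UI`, **`EE_UI`** (`(QGQ*)⁻¹` agrees: `E₂(Uω) = U(E₁ω)`), **`H_UI`**
  (`(GQ*(QGQ*)⁻¹)₂(Uω) = (GQ*(QGQ*)⁻¹)₁ω` on the fine bonds), `onFun_H_single` (the bond-function readings against `Pi.single` agree);
* §2 for `padT`: `base_pad`, **`beta_pad`** (`β` of the padded family is the relabelled `β`), `len_pad`;
* §3 **`cor28_kLevel_H_DH_pad`** = `cor28_kLevel_H_DH` with the binder list `(1 ≤ k, k + 1 ≤ m + K, P′ = L·P″, P″ ≥ 5)` in place of `(2 ≤ k, P′ ≥ 5, Placed)`, SAME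
  constants `σ₁, δ₅, C, M₂, N₁` and the same two conclusions for the genuine `H` of `domT hN D hk`.
HONEST SCOPE: bookkeeping over landed certificates (r03's Cor. 2.8 chain, p38's padding); inherits their standing hypotheses `M_h = Lᵃ ≥ 8`, `R ≥ 2L²`, `4 ≤ ℓ`, the (2.16)
band, `M₂ ≤ L·M_h`, `N₁ + 1 ≤ R·L·M_h`; the Hölder entry of (2.151) is not touched.  NOT a claim about the mass gap.

References: T. Bałaban, CMP **96** (1984) 223–250 [Balaban1984PropagatorsII] (2.1)–(2.4) p.224, (2.35) p.228, (2.46) p.231, Cor. 2.8 (2.150)–(2.151) p.249.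
-/

set_option autoImplicit false

noncomputable section

open scoped BigOperators InnerProductSpace

namespace Summit.QuantumFields.YangMills.Theorems.FlatPortCor28PadL0

open FlatPortCor28Pad (UI_single qgqE_UI EE_UI H_UI onFun_H_single)

open Literature.MathematicalPhysics.QuantumFieldTheory.Balaban1983to89
open Literature.MathematicalPhysics.QuantumFieldTheory.BalabanImbrieJaffe1984to88.BIJ85AxialPropagator411 (BondSpace)
open B5Eq118OneStroke (iterBlockOf)
open B6MultiLevelBoxOperator (N0)
open B6MultiLevelTorusOperatorL0 (TDomains)
open B6Geom246MultiLevelBoxL0 (bset blkOf)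
open B6Geom246MultiLevelTorusL0 (geomT)
open B6GlobalChartV1 (PV toBox)
open B6GlobalChartV1L0 (blkV1 domT)
open B6Ineq2142KLevelV1L0 (lvl β base baseSite iterBlockOf_baseSite blkOf_eq_beta)
open B6Ineq2133TwoScaleV1 (onFun onFun_apply)
open B6GradLegKLevelV1 (DV)
open B6SectADomainsV1 (Domains)
open B6SectAOperatorsV1 (BondIdx BondIdxSpace QE QsE)
open B6SectAVectorModelV1 (GE EE qgqE qgqE_def comp_EE EE_comp)
open B6CubeWindowV1 (Placed GlobalBand)
open B6Cover236MultiLevelBlocksL0 (cubes)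
open B6PadLevelV1 (SameOm hN_pad)
open B6PadLevelV1L0 (padT padT_lev placed_pad sameOm_domT_pad eT eT_blkV1 dist_eT globalBand_pad)
open B6Cor28EntriesKLevelV1L0 (cor28_kLevel_H_DH)

/-! ## §1 Transport of `(QGQ*)⁻¹` and `H` along `SameOm` -/

/-! ## §2 The carrier blocks `β` and the block lengths of the padded family -/

section PadGeom

variable {d ℓ m K : ℕ} {hd : 1 ≤ d + 1} {hL : Odd (ℓ + 1) ∧ 1 < ℓ + 1}
variable {Mh k R : ℕ} {P' P'' : Fin (d + 1) → ℕ}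
variable (hN : ∀ μ, N0 ℓ Mh k P' μ = (PV d ℓ m K hd hL).sitesPerDir 0) (D : TDomains d ℓ Mh k P' R) (hk : k ≤ m + K)
variable (hLP : ∀ μ, P' μ = (ℓ + 1) * P'' μ) (hk' : k + 1 ≤ m + K)

/-- the base end-point of an index bond is the same in the padded family (same `Ω_j`). [cite: Balaban1984PropagatorsII, (2.3) p.224, bookkeeping] -/
theorem base_pad (cI : BondIdx (B6GlobalChartV1L0.domT hN D hk)) :
    base (hN_pad hN hLP) (padT D hLP) hk' ((sameOm_domT_pad hN D hk hLP hk').idxB.symm cI) = base hN D hk cI := by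
  set hS := sameOm_domT_pad hN D hk hLP hk'
  unfold base
  by_cases hm : cI.1.2.src ∈ (domT hN D hk).Om (lvl hN D hk cI)
  · have hm' : (hS.idxB.symm cI).1.2.src ∈ (domT (hN_pad hN hLP) (padT D hLP) hk').Om (lvl (hN_pad hN hLP) (padT D hLP) hk' (hS.idxB.symm cI)) :=
      (hS.mem_Om _ _).2 hm
    rw [if_pos hm', if_pos hm]
    rfl
  · have hm' : (hS.idxB.symm cI).1.2.src ∉ (domT (hN_pad hN hLP) (padT D hLP) hk').Om (lvl (hN_pad hN hLP) (padT D hLP) hk' (hS.idxB.symm cI)) :=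
      fun h' => hm ((hS.mem_Om _ _).1 h')
    rw [if_neg hm', if_neg hm]
    rfl

/-- **THE CARRIER BLOCK `β` OF THE PADDED FAMILY IS THE RELABELLED CARRIER BLOCK** (both are the block of `𝔅` containing `B^j(base c)`).
[cite: Balaban1984PropagatorsII, (2.45) p.231] -/
theorem beta_pad (cI : BondIdx (B6GlobalChartV1L0.domT hN D hk)) :
    β (hN_pad hN hLP) (padT D hLP) hk' ((sameOm_domT_pad hN D hk hLP hk').idxB.symm cI) = eT D hLP (β hN D hk cI) := by
  set hS := sameOm_domT_pad hN D hk hLP hk'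
  set x : Site (PV d ℓ m K hd hL) 0 := baseSite (hN_pad hN hLP) (padT D hLP) hk' (hS.idxB.symm cI) with hx
  -- `x` lies over `base c`
  have hxb : iterBlockOf (lvl hN D hk cI) x = base hN D hk cI := by
    have h1 := iterBlockOf_baseSite (hN_pad hN hLP) (padT D hLP) hk' (hS.idxB.symm cI)
    rw [base_pad hN D hk hLP hk'] at h1
    exact h1
  -- in `D`, the block of `x` is `β c`
  have hD : blkOf D.toDomains (toBox hN x) = β hN D hk cI := blkOf_eq_beta hN D hk cI hxb
  -- in the padded family, `β` is the block of `x` by definition; the block maps agree (`eT_blkV1` at the bond `⟨x, 0⟩`)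
  have hpad : β (hN_pad hN hLP) (padT D hLP) hk' (hS.idxB.symm cI) = blkV1 (hN_pad hN hLP) (padT D hLP) ⟨x, ⟨0, hd⟩⟩ := rfl
  rw [hpad, ← eT_blkV1 D hLP hN]
  show eT D hLP (blkOf D.toDomains (toBox hN x)) = _
  rw [hD]

/-- the block lengths are unchanged (same level, same `L`, `η = 1`). [cite: Balaban1984PropagatorsII, (2.46) p.231, bookkeeping] -/
theorem len_pad (f : PBond (PV d ℓ m K hd hL) 0) : (geomT (padT D hLP)).len (B6GlobalChartV1L0.blkV1 (hN_pad hN hLP) (padT D hLP) f) = (geomT D).len (blkV1 hN D f) := rfl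

omit hk' in
/-- the block length of a relabelled block is unchanged. [cite: Balaban1984PropagatorsII, (2.46) p.231, bookkeeping] -/
theorem len_eT (y : ↥(bset D.toDomains)) : (B6Geom246MultiLevelTorusL0.geomT (padT D hLP)).len (eT D hLP y) = (geomT D).len y := rfl

end PadGeom

/-! ## §3 Corollary 2.8 (2.151)₁,₂ at k levels without the placement hypothesis, `k ≥ 1` -/

section Main

variable {d ℓ : ℕ}

/-- **[B6] COROLLARY 2.8 (2.151)₁,₂ AT k LEVELS FOR THE GENUINE `H = GQ*(QGQ*)⁻¹`, EVERY ODD `L ≥ 5`, `k ≥ 1`, NO PLACEMENT HYPOTHESIS** — the binders of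
`B6Cor28EntriesKLevelV1L0.cor28_kLevel_H_DH` with `(2 ≤ k, P′ ≥ 5, all cubes placed)` replaced by `(1 ≤ k, k + 1 ≤ m + K, P′ = L·P″, P″ ≥ 5)` (pad by one empty level,
`placed_pad`; transport along `sameOm_domT_pad`): there are `σ₁ > 0` and, for every `σ ∈ (0, σ₁]`, `α ∈ (0, 1)`, constants `δ₅ > 0`, `C ≥ 0`, `M₂ > 0`, `N₁` such that
for every such torus family, weights in the band, index bond `c`, fine bond `f`, direction `ν`:
`|(He_c)(f)| ≤ C·e^{−δ₅·d_T(y(f), β c)}` and `|(∇_νHe_c)(f)| ≤ C·(L^{j(y(f))}η)⁻¹·e^{−δ₅·d_T(y(f), β c)}`.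
[cite: Balaban1984PropagatorsII, Cor. 2.8 (2.150)–(2.151) p.249, (2.1)–(2.4) p.224] -/
theorem cor28_kLevel_H_DH_pad (d ℓ : ℕ) (hd : 1 ≤ d + 1) (hL : Odd (ℓ + 1) ∧ 1 < ℓ + 1) {b₀ b₁ : ℝ} (hb₀ : 0 < b₀) (hb₁ : b₀ ≤ b₁) :
    ∃ σ₁ : ℝ, 0 < σ₁ ∧ ∀ (σ : ℝ), 0 < σ → σ ≤ σ₁ → ∀ (α : ℝ), 0 < α → α < 1 →
    ∃ (δ₅ C M₂ : ℝ) (N₁ : ℕ), 0 < δ₅ ∧ 0 ≤ C ∧ 0 < M₂ ∧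
    ∀ (m K : ℕ) {Mh k R : ℕ} {P' : Fin (d + 1) → ℕ}
      (hN : ∀ μ, N0 ℓ Mh k P' μ = (PV d ℓ m K hd hL).sitesPerDir 0) (D : TDomains d ℓ Mh k P' R) (hk : k ≤ m + K) (_ : 1 ≤ k) (_ : k + 1 ≤ m + K)
      {P'' : Fin (d + 1) → ℕ} (_ : ∀ μ, P' μ = (ℓ + 1) * P'' μ) (_ : ∀ μ, 5 ≤ P'' μ)
      {a : ℕ} (_ : Mh = (ℓ + 1) ^ a) (_ : 8 ≤ Mh) (_ : 2 * (ℓ + 1) ^ 2 ≤ R) (_ : 4 ≤ ℓ)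
      (_ : M₂ ≤ ((ℓ : ℝ) + 1) * Mh) (_ : N₁ + 1 ≤ R * ((ℓ + 1) * Mh))
      {cf : ℝ} (hcf : cf ≠ 0) {w : BondIdx (B6GlobalChartV1L0.domT hN D hk) → ℝ} (hw : ∀ i, 0 < w i) (_ : GlobalBand b₀ b₁ cf w),
      (∀ (c : BondIdx (domT hN D hk)) (f : PBond (PV d ℓ m K hd hL) 0),
        |(GE (domT hN D hk) hcf hw ∘ₗ QsE (domT hN D hk) ∘ₗ EE (domT hN D hk) hcf hw) (EuclideanSpace.single c (1 : ℝ)) f| ≤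
          C * Real.exp (-(δ₅ * (geomT D).dist (blkV1 hN D f) (β hN D hk c)))) ∧
      (∀ (ν : Fin (d + 1)) (c : BondIdx (domT hN D hk)) (f : PBond (PV d ℓ m K hd hL) 0),
        |(DV ν cf ∘ₗ onFun (GE (domT hN D hk) hcf hw ∘ₗ QsE (domT hN D hk) ∘ₗ EE (domT hN D hk) hcf hw)) (Pi.single c 1) f| ≤
          C * ((geomT D).len (blkV1 hN D f) * |cf|⁻¹)⁻¹ * Real.exp (-(δ₅ * (geomT D).dist (blkV1 hN D f) (β hN D hk c)))) := by
  obtain ⟨σ₁, hσ₁, h⟩ := cor28_kLevel_H_DH d ℓ hd hL hb₀ hb₁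
  refine ⟨σ₁, hσ₁, fun σ hσ hσ1 α hα hα1 => ?_⟩
  obtain ⟨δ₅, C, M₂, N₁, hδ₅, hC, hM₂, hH⟩ := h σ hσ hσ1 α hα hα1
  refine ⟨δ₅, C, M₂, N₁, hδ₅, hC, hM₂, ?_⟩
  intro m K Mh k R P' hN D hk _hk1 hk' P'' hLP hP5 a hMha hM8 hR2 hℓ hM hRM cf hcf w hw hwb
  -- the padded family and the transport data
  have hS := sameOm_domT_pad hN D hk hLP hk'
  have hw' : ∀ i, 0 < (w ∘ hS.idxB) i := fun i => hw _
  obtain ⟨key1, key2⟩ := hH m K (hN_pad hN hLP) (padT D hLP) hk' (by omega) hMha hM8 hR2 hP5 hℓ (placed_pad D hLP hP5) hM hRM hcf hw'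
    (globalBand_pad D hLP hN hk hk' hwb)
  constructor
  · intro c f
    have h1 := key1 (hS.idxB.symm c) f
    rw [UI_single hS c, H_UI hS hcf hw hw', ← eT_blkV1 D hLP hN, beta_pad hN D hk hLP hk' c, dist_eT] at h1
    exact h1
  · intro ν c f
    have h2 := key2 ν (hS.idxB.symm c) f
    rw [LinearMap.comp_apply, onFun_H_single hS hcf hw hw' c, ← eT_blkV1 D hLP hN, beta_pad hN D hk hLP hk' c, dist_eT, len_eT D hLP] at h2
    rw [LinearMap.comp_apply]
    exact h2

end Main

end Summit.QuantumFields.YangMills.Theorems.FlatPortCor28PadL0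

end
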